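import Literature.NumberTheory.EllipticCurves.ComplexMultiplicationBurungaleFlachFiniteThreeLeavesProofs
import Literature.NumberTheory.EllipticCurves.ComplexMultiplicationBurungaleFlachDescentLeavesProofs
import HarnessLib

/-!
# bsd.S28 (Burungale–Flach) from seven leaves: the continuation leaf removed everywhere

Sibling of `ComplexMultiplicationBurungaleFlachDescentLeavesProofs.lean` (bsd.S28 =
`Literature.NumberTheory.EllipticCurves.bsdTriple_of_j_mem_maximalCMJInvariants_of_L_one_ne_zero`,
the full rank-zero Birch–Swinnerton-Dyer statement for `E/ℚ` with CM by `𝓞_K` and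
`L(E, 1) ≠ 0` — Burungale–Flach, Camb. J. Math. 12 (2024), Thm. 1.1, Cor. 1, Cor. 2 — from eight
named facts) and of `ComplexMultiplicationBurungaleFlachFiniteThreeLeavesProofs.lean` (D-0014
append protocol: a new file, everything proved, no definitions, no named fact introduced or
restated). Of the eight leaves, the **Deuring–Hecke continuation** of `L(E/ℚ, s)`
(`hasEntireLFunction_of_j_mem_maximalCMJInvariants`, Silverman *Advanced Topics* II Cor. 10.5.1)
entered the assembly at three points, always through the value `L(E/ℚ, 1)` of the tree's
`W.entireLFunction`:

1. the finiteness half of Thm. 1.1 over `K` (`…_finite_primary_cmField_of_Deuring`): to get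
   `L(E_K/K, 1) = L(E/ℚ, 1)² ≠ 0` for Rubin 1987 §10 — removed in the sibling
   (`BurungaleFlach2024_finite_primary_cmField_of_classical_leaves`, by
   `entireLFunction_one_ne_zero_of_LFunction_eq_mul_self`);
2. Cor. 1 over `K` from Thm. 1.1 (`BurungaleFlach2024_bsd_cmField_of_main_of_hecke`): the same
   identity, and the realness of `L(E/ℚ, 1)` (`conj_entireLFunction_ofReal`);
3. the descent Cor. 2 (`BurungaleFlach2024_bsd_rat_of_bsd_cmField_of_level5`, through
   `bsd_rat_of_bsd_imaginaryQuadratic_of_LFunction_eq_mul_self`): the same identity again.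

All three uses are unconditional theorems: the identity by
`entireLFunction_one_eq_sq_of_LFunction_eq_mul_self_of_ne_zero` (`AnalyticRankEntireValueProofs`;
the hypothesis `L(E/ℚ, 1) ≠ 0` of bsd.S28, of Cor. 1 and of the descent fact is exactly what it
needs), and the realness by `WeierstrassCurve.conj_entireLFunction'` below (integer Dirichlet
coefficients; if no continuation exists the tree's `L(E, s)` is the series itself). Hence:

* `WeierstrassCurve.conj_entireLFunction'`, `…_ofReal'`, `entireLFunction_ofReal_im'`
  (**proved**): `conj L(W, s) = L(W, s̄)` for the tree's `entireLFunction` of every Weierstrass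
  curve over every number field, with no continuation hypothesis;
* `BurungaleFlach2024_bsd_cmField_of_main_of_Deuring` (**proved**): Cor. 1 at `F = K` from
  Thm. 1.1 over `K` and Deuring's identity only (the printed proof, p. 3);
* `WeierstrassCurve.bsd_rat_of_bsd_imaginaryQuadratic_of_entireLFunction_one_eq_sq`
  (**proved**): the generic descent with its analytic input reduced to the single number
  `L(E_K/K, 1) = L(E/ℚ, 1)²`; `BurungaleFlach2024_bsd_rat_of_bsd_cmField_of_level6`
  (**proved**): the descent fact from Deuring, Milne 1972 Thm. 1 (quotient form), Cassels'
  isogeny invariance and `L(E,1) ≥ 0` — level 5 without `hH`;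
* `bsdTriple_of_j_mem_maximalCMJInvariants_of_L_one_ne_zero_of_seven_leaves` (**proved**, the
  census): bsd.S28 follows, sorry-free, from **seven** named facts —
  1. `BurungaleFlach2024_main_cmField_pPart` (Prop. 2.3 with Lemma 13 at `F = K`: the paper's
     contribution — Johnson-Leung–Kings' two-variable main conjecture, the descent Prop. 4.1,
     Kato's explicit reciprocity law);
  2. `Rubin1987_sha_primary_finite` (Rubin 1987, §10);
  3. `CoatesWiles1977_L_one_div_period_mem_prime` (Coates–Wiles 1977, §6);
  4. `Deuring_LFunction_baseChange_cmField` (Deuring, `L(E_K/K, s) = L(E/ℚ, s)²`);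
  5. `bsdRHS_baseChange_quadratic` (Milne 1972, Thm. 1, rank-zero quotient form);
  6. `bsdRHS_eq_of_isIsogenous` (Cassels 1965 / Milne *ADT* I.7.3);
  7. `re_entireLFunction_one_nonneg` (`L(E, 1) ≥ 0`; Guo 1996, Lapid–Rallis 2003) —
  i.e. the eight of `…_of_eight_leaves` minus the Deuring–Hecke continuation, nothing added.
* `BurungaleFlach2024_main_cmField_of_four_leaves`, `…_iff_pPart_of_three_leaves` (**proved**):
  likewise Theorem 1.1 over `K` (`BurungaleFlach2024_main_cmField`) from leaves 1–4, sharpening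
  the six-leaf census of `…MainLeavesProofs.lean`.

## References

* A. Burungale, M. Flach, *The conjecture of Birch and Swinnerton-Dyer for certain elliptic curves
  with complex multiplication*, Camb. J. Math. 12 (2024) (arXiv:2206.09874): Thm. 1.1 and its
  proof (p. 22), Cor. 1 and its proof (p. 3), Cor. 2 and its proof (p. 4), Remark 10 (p. 19).
  [BurungaleFlach2024]
* J. S. Milne, *On the arithmetic of abelian varieties*, Invent. Math. 17 (1972), Thm. 1, Thm. 3
  and Corollary. [Milne1972ArithmeticAV]
* J. H. Silverman, *Advanced Topics in the Arithmetic of Elliptic Curves* (1994), Ch. II Thm. 10.5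
  and Cor. 10.5.1 (the leaf removed). [SilvermanATAEC1994]
-/

noncomputable section

open scoped Classical ComplexConjugate

/-! ### `conj L(W, s) = L(W, s̄)` without a continuation hypothesis -/

namespace WeierstrassCurve

open Complex

variable {K₀ : Type*} [Field K₀] [NumberField K₀] (W : WeierstrassCurve K₀)

/-- **`conj L(W, s) = L(W, s̄)` for the tree's entire `L`-function, unconditionally.** If
`L(W, s)` has an entire continuation this is `conj_entireLFunction` (Schwarz reflection and
uniqueness of the continuation); if not, `W.entireLFunction` is the `L`-series
`∑ aₙ(W) n⁻ˢ` itself (`entireLFunction_eq_LSeries_of_not_hasEntireLFunction`), whose coefficients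
are integers (`conj_LSeries_intCast`). Deliberate dot-notation extension of Mathlib's
`WeierstrassCurve`. [folklore] -/
theorem conj_entireLFunction' (s : ℂ) :
    conj (W.entireLFunction s) = W.entireLFunction (conj s) := by
  by_cases h : W.HasEntireLFunction
  · exact W.conj_entireLFunction h s
  · rw [W.entireLFunction_eq_LSeries_of_not_hasEntireLFunction h]
    exact conj_LSeries_intCast (fun n => W.LFunction n) s

/-- In particular `L(W, x)` is real for real `x`, unconditionally: `conj L(W, x) = L(W, x)`.
Deliberate dot-notation extension of Mathlib's `WeierstrassCurve`. [folklore] -/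
theorem conj_entireLFunction_ofReal' (x : ℝ) :
    conj (W.entireLFunction x) = W.entireLFunction x := by
  rw [W.conj_entireLFunction', conj_ofReal]

/-- `Im L(W, x) = 0` for real `x`, unconditionally. Deliberate dot-notation extension of
Mathlib's `WeierstrassCurve`. [folklore] -/
theorem entireLFunction_ofReal_im' (x : ℝ) : (W.entireLFunction x).im = 0 :=
  Complex.conj_eq_iff_im.mp (W.conj_entireLFunction_ofReal' x)

end WeierstrassCurve

/-! ### Corollary 1 over `K` from Theorem 1.1 and Deuring only -/

open Complex NumberField WeierstrassCurve

namespace Literature.NumberTheory.EllipticCurves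

/-- **Corollary 1 at `F = K` from Theorem 1.1, by the printed proof, with Deuring's identity as
the only analytic input** (Burungale–Flach 2024, proof of Cor. 1, arXiv p. 3; the rerun of
`BurungaleFlach2024_bsd_cmField_of_main_of_hecke` without its continuation hypothesis). Given
Theorem 1.1 with Remark 1 over `K` (`hT`) and Deuring's `L(E_K/K,s) = L(E/ℚ,s)²` (`hD`): for
`W, K, W'` as in the leaf, take the infinite place `w` of `K`, `σ = σ_w`, and the period data of
`W'` along `σ` (`Λ = Ω·𝓞_K`, the proved CM period lattice); Theorem 1.1 gives finiteness and
`z ∈ K`, `v ∈ 𝓞_K^×` with `σz · Ω = L(E/ℚ,1)`, `z² #E(K)² = v · #Ш · ∏ c_v`; then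
`L(E_K/K,1) = L(E/ℚ,1)²` (`entireLFunction_one_eq_sq_of_LFunction_eq_mul_self_of_ne_zero`, using
the hypothesis `L(E/ℚ,1) ≠ 0` of the statement) with `L(E/ℚ,1)` real
(`conj_entireLFunction_ofReal'`), `Ω(E_K) = |Ω|²` ((periodnorm)) and `|σ v| = 1`, whence
`L(E_K/K,1)/Ω(E_K) = |σz|² = #Ш ∏ c_v / #E(K)²`.
[cite: BurungaleFlach2024, Cor. 1 and its proof (arXiv p. 3)]
[cite: SilvermanATAEC1994, Ch. II Thm. 10.5 (a), (b)] -/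
theorem BurungaleFlach2024_bsd_cmField_of_main_of_Deuring (hT : BurungaleFlach2024_main_cmField)
    (hD : Deuring_LFunction_baseChange_cmField) : BurungaleFlach2024_bsd_cmField := by
  intro W _ hj hL K _ _ hK W' _ _ hW'
  -- the infinite place and the embedding
  obtain ⟨w⟩ : Nonempty (InfinitePlace K) := inferInstance
  set σ : K →+* ℂ := w.embedding with hσ
  -- the period data of `W'` along `σ`: `Λ = Ω · 𝓞_K` (singular moduli, proved)
  obtain ⟨L, Ω, h₂, h₃, hLΩ⟩ := exists_periodPair_of_smul_baseChange
    exists_isCMPeriod_of_j_mem_maximalCMJInvariants_holds W hj W' hW' σ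
  -- Theorem 1.1 over `K`
  obtain ⟨hfin, hsha, z, v, hz, hzv⟩ := hT W hj hL K hK W' hW' σ L Ω h₂ h₃ hLΩ
  refine ⟨hfin, hsha, ?_⟩
  -- (periodnorm): `Ω(E_K) = |Ω|²`
  have hΩ : W'.bsdPeriod = ‖Ω‖ ^ 2 := bsdPeriod_eq_norm_sq_of_coe_lattice_eq hj hK W' w h₂ h₃ hLΩ
  have hΩ0 : Ω ≠ 0 := ne_zero_of_coe_lattice_eq_image L hLΩ
  -- Deuring: `L(E_K/K, 1) = L(E/ℚ,1)² = |L(E/ℚ,1)|²`, unconditionally in the continuation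
  obtain ⟨C, rfl⟩ := hW'
  haveI : (W.baseChange K).IsElliptic := by rw [baseChange]; infer_instance
  have hLK : (C • W.baseChange K).entireLFunction 1 = W.entireLFunction 1 ^ 2 := by
    rw [entireLFunction_smul]
    exact entireLFunction_one_eq_sq_of_LFunction_eq_mul_self_of_ne_zero (hD W hj K hK) hL
  have hreal : conj (W.entireLFunction 1) = W.entireLFunction 1 := by
    have := W.conj_entireLFunction_ofReal' 1
    rwa [Complex.ofReal_one] at this
  -- `N_{K/ℚ}`: units have absolute value `1`
  have hv : ‖σ ((v : 𝓞 K) : K)‖ = 1 :=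
    norm_embedding_unit_eq_one (hK.card_infinitePlace hj) σ v
  -- `E(K)` is finite and nonempty
  haveI := hfin
  have hcard : Nat.card (C • W.baseChange K).toAffine.Point ≠ 0 := Nat.card_pos.ne'
  -- the ideal identity under `σ`
  have hzv' : (σ z) ^ 2 * (Nat.card (C • W.baseChange K).toAffine.Point : ℂ) ^ 2 =
      σ ((v : 𝓞 K) : K) * ((C • W.baseChange K).shaOrder : ℂ) *
        ((C • W.baseChange K).tamagawaProduct : ℂ) := by
    have := congrArg σ hzv
    simpa using this
  rw [hLK, hΩ]
  exact sq_div_norm_sq_eq_of_norm_eq (W.entireLFunction 1) _ (σ z) _ _ _ _ hcard hΩ0 hz hreal hv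
    hzv'

/-- **Corollary 1 at `F = K` from the three printed inputs of its proof**: Prop. 4.1 at `F = K`
(`hA`), Prop. 2.3 with Lemma 13 at `F = K` (`hB`) and Deuring's identity (`hD`) — the sibling's
`BurungaleFlach2024_bsd_cmField_of_printed_leaves` without the continuation leaf.
[cite: BurungaleFlach2024, Thm. 1.1 and its proof (p. 22), Cor. 1 and its proof (p. 3)] -/
theorem BurungaleFlach2024_bsd_cmField_of_printed_leaves_of_Deuring
    (hA : BurungaleFlach2024_finite_primary_cmField) (hB : BurungaleFlach2024_main_cmField_pPart)
    (hD : Deuring_LFunction_baseChange_cmField) : BurungaleFlach2024_bsd_cmField :=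
  BurungaleFlach2024_bsd_cmField_of_main_of_Deuring
    (BurungaleFlach2024_main_cmField_of_halves hA hB) hD

/-- **Corollary 1 at `F = K` from four leaves**: Prop. 2.3 with Lemma 13 at `F = K` (`hB`),
Rubin 1987 §10 (`hR`), Coates–Wiles 1977 §6 (`h1`) and Deuring's identity (`hD`) — the sibling's
six-leaf `BurungaleFlach2024_bsd_cmField_of_classical_leaves` with Artin formalism and the Euler
factors of the Tate module replaced by the Deuring leaf they produced, and the continuation leaf
dropped. [cite: BurungaleFlach2024, Thm. 1.1, Cor. 1 and proof of Thm. 1.1 (arXiv pp. 3, 22)] -/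
theorem BurungaleFlach2024_bsd_cmField_of_four_leaves
    (hB : BurungaleFlach2024_main_cmField_pPart) (hR : Rubin1987_sha_primary_finite)
    (h1 : CoatesWiles1977_L_one_div_period_mem_prime)
    (hD : Deuring_LFunction_baseChange_cmField) : BurungaleFlach2024_bsd_cmField :=
  BurungaleFlach2024_bsd_cmField_of_printed_leaves_of_Deuring
    (BurungaleFlach2024_finite_primary_cmField_of_three_leaves h1 hR hD) hB hD

end Literature.NumberTheory.EllipticCurves

/-! ### The descent with the analytic input reduced to one number -/

namespace WeierstrassCurve

open Complex NumberField Literature.NumberTheory.EllipticCurves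

/-- **Descent of the rank-zero BSD formula from an imaginary quadratic field to `ℚ`, analytic
input: the single identity `L(E_K/K, 1) = L(E, 1)²`** — the theorem
`bsd_rat_of_bsd_imaginaryQuadratic_of_LFunction_eq_mul_self` of the sibling (Milne 1972, Cor. to
Thm. 3 / Burungale–Flach 2024, proof of Cor. 2) with its two analytic hypotheses (`L(E, s)` has an
entire continuation; `L(E_K/K, s) = L(E, s)²` formally) replaced by the one consequence the proof
uses, `hLK1`. The rest is verbatim: `E(ℚ) ↪ E(K)` finite; `Ш(E/ℚ) → Ш(E_K/K)` has finite kernel;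
Milne's theorem (`hBC`) for a minimal model of the twist `E^{(D)}`, `D = disc K`; Cassels
(`hISO`) along `E ∼ E^{(D)}` (`hiso`); `L(E,1)² = RHS(W)²`, `RHS(W) ≥ 0` and `L(E,1) ≥ 0`
(`hPOS`) give `L(E,1) = RHS(W)`. Deliberate dot-notation extension of Mathlib's
`WeierstrassCurve`, next to the theorem it varies.
[cite: BurungaleFlach2024, proof of Cor. 2 (arXiv p. 4)]
[cite: Milne1972ArithmeticAV, Thm. 1, Thm. 3 and Corollary (through BurungaleFlach2024)] -/
theorem bsd_rat_of_bsd_imaginaryQuadratic_of_entireLFunction_one_eq_sq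
    (hBC : bsdRHS_baseChange_quadratic) (hISO : bsdRHS_eq_of_isIsogenous)
    (hPOS : re_entireLFunction_one_nonneg)
    (W : WeierstrassCurve ℚ) [W.IsElliptic] [W.IsGloballyMinimal]
    (K : Type) [Field K] [NumberField K] [IsTotallyComplex K] (h2 : Module.finrank ℚ K = 2)
    (hiso : IsIsogenous W (W.quadraticTwist (NumberField.discr K : ℚ)))
    (hLK1 : (W.baseChange K).entireLFunction 1 = W.entireLFunction 1 ^ 2)
    (W' : WeierstrassCurve K) [W'.IsElliptic] [W'.IsGloballyMinimal]
    (hW' : ∃ C : VariableChange K, C • W.baseChange K = W')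
    (hfin : Finite W'.toAffine.Point) (hsha : W'.ShaFinite)
    (hform : W'.entireLFunction 1 / (W'.bsdPeriod : ℂ) =
      (W'.shaOrder : ℂ) / (Nat.card W'.toAffine.Point : ℂ) ^ 2 * (W'.tamagawaProduct : ℂ)) :
    Finite W.toAffine.Point ∧ W.ShaFinite ∧
      W.entireLFunction 1 / (W.realPeriodRat : ℂ) =
        (W.shaOrder : ℂ) / (Nat.card W.toAffine.Point : ℂ) ^ 2 * (W.tamagawaProduct : ℂ) := by
  obtain ⟨C, rfl⟩ := hW'
  set D : ℚ := (NumberField.discr K : ℚ) with hD_def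
  have hD : D ≠ 0 := by
    rw [hD_def]
    exact_mod_cast NumberField.discr_ne_zero K
  haveI hEt : (W.quadraticTwist D).IsElliptic := W.isElliptic_quadraticTwist hD
  haveI hEK : (W.baseChange K).IsElliptic := by rw [baseChange]; infer_instance
  -- (1) `E(ℚ)` is finite
  haveI hfinK : Finite (W.baseChange K).toAffine.Point :=
    Finite.of_equiv _ (VariableChange.pointEquiv (W.baseChange K) C).symm.toEquiv
  have hfinQ : Finite W.toAffine.Point := finite_point_of_finite_point_baseChange W K
  -- (2) a globally minimal model of the twist
  obtain ⟨CD, hCD⟩ := hasGlobalMinimalModel_rat_holds (W.quadraticTwist D)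
  haveI := hCD
  -- (3) `Ш(E/ℚ)` is finite (restriction to `K` has finite kernel); Milne: the quotients multiply
  have hshaQ : W.ShaFinite := by
    have e : (C • W.baseChange K).ShaFinite ↔ (W.baseChange K).ShaFinite :=
      shaFinite_variableChange_iff_holds (W.baseChange K) C
    exact Literature.NumberTheory.EllipticCurves.shaFinite_of_baseChange W K (e.mp hsha)
  have hRHS :=
    hBC W K h2 (CD • W.quadraticTwist D) ⟨CD, rfl⟩ (C • W.baseChange K) ⟨C, rfl⟩ hfin hsha
  -- (4) the twist is isogenous to `W`: same BSD quotient (Cassels)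
  have hisoD : IsIsogenous W (CD • W.quadraticTwist D) := hiso.smul_right CD
  obtain ⟨-, hRHSD⟩ := hISO W (CD • W.quadraticTwist D) hisoD hshaQ
  -- (5) `L(E_K,1) = L(E,1)²`, the given number
  have hLK1' : (C • W.baseChange K).entireLFunction 1 =
      W.entireLFunction 1 * W.entireLFunction 1 := by
    rw [entireLFunction_smul, hLK1, sq]
  -- (6) the formula over `K`, cleared of denominators
  have hΩK : 0 < (C • W.baseChange K).bsdPeriod := bsdPeriod_pos' _
  have hΩK' : ((C • W.baseChange K).bsdPeriod : ℂ) ≠ 0 := by exact_mod_cast hΩK.ne'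
  have hform' : (C • W.baseChange K).entireLFunction 1 =
      (((C • W.baseChange K).bsdPeriod * ((C • W.baseChange K).shaOrder : ℝ) *
          ((C • W.baseChange K).tamagawaProduct : ℝ) /
          (Nat.card (C • W.baseChange K).toAffine.Point : ℝ) ^ 2 : ℝ) : ℂ) := by
    rw [div_eq_iff hΩK'] at hform
    rw [hform]
    push_cast
    ring
  rw [hRHS, hRHSD] at hform'
  -- (7) square roots
  have hsq : W.entireLFunction 1 ^ 2 = (W.bsdRHS : ℂ) ^ 2 := by
    rw [sq, sq, ← hLK1', hform']
    push_cast
    ring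
  have hR : 0 ≤ W.bsdRHS := by
    haveI := hfinQ
    rw [W.bsdRHS_eq_of_finite]
    have hΩ : 0 < W.realPeriodRat := W.realPeriodRat_pos_holds
    positivity
  have hLR : W.entireLFunction 1 = (W.bsdRHS : ℂ) :=
    Complex.eq_of_sq_eq_sq_of_re_nonneg hR (hPOS W) hsq
  refine ⟨hfinQ, hshaQ, ?_⟩
  haveI := hfinQ
  have hΩ : (W.realPeriodRat : ℂ) ≠ 0 := by
    exact_mod_cast (ne_of_gt (W.realPeriodRat_pos_holds : 0 < W.realPeriodRat))
  rw [div_eq_iff hΩ, hLR, W.bsdRHS_eq_of_finite]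
  push_cast
  ring

end WeierstrassCurve

/-! ### Level 6 of the descent and the seven-leaf assembly -/

namespace Literature.NumberTheory.EllipticCurves

/-- **The descent fact from Deuring, Milne, Cassels and the sign of `L(E,1)` — level 6.**
`BurungaleFlach2024_bsd_rat_of_bsd_cmField` ("rank-zero BSD for `E_K/K` ⇒ rank-zero BSD for
`E/ℚ`"; Burungale–Flach 2024, proof of Cor. 2 at `F⁺ = ℚ`) follows from Deuring's
`L(E_K/K, s) = L(E/ℚ, s)²` (`hD`), Milne's theorem on the BSD quotient of the Weil restriction
(`hBC`), Cassels' isogeny invariance (`hISO`) and `L(E,1) ≥ 0` (`hPOS`): level 5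
(`…_of_level5`) without the Deuring–Hecke continuation, its only use — `L(E_K/K,1) = L(E/ℚ,1)²`
— being supplied by `entireLFunction_one_eq_sq_of_LFunction_eq_mul_self_of_ne_zero` from the
hypothesis `L(E/ℚ, 1) ≠ 0` of the fact. [cite: BurungaleFlach2024, proof of Cor. 2 (arXiv p. 4)]
[cite: Milne1972ArithmeticAV, Thm. 1, Thm. 3 and Corollary (through BurungaleFlach2024)] -/
theorem BurungaleFlach2024_bsd_rat_of_bsd_cmField_of_level6
    (hD : Deuring_LFunction_baseChange_cmField)
    (hBC : bsdRHS_baseChange_quadratic) (hISO : bsdRHS_eq_of_isIsogenous)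
    (hPOS : re_entireLFunction_one_nonneg) :
    BurungaleFlach2024_bsd_rat_of_bsd_cmField := by
  intro W _ _ hj hL K _ _ hK W' _ _ hW' hBSDK
  haveI : IsTotallyComplex K := hK.isTotallyComplex hj
  exact bsd_rat_of_bsd_imaginaryQuadratic_of_entireLFunction_one_eq_sq hBC hISO hPOS W K hK.1
    (isIsogenous_quadraticTwist_discr_of_isCMFieldOfJ isIsogenous_quadraticTwist_cmFieldDiscr_holds
      W hj K hK)
    (entireLFunction_one_eq_sq_of_LFunction_eq_mul_self_of_ne_zero (hD W hj K hK) hL)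
    W' hW' hBSDK.1 hBSDK.2.1 hBSDK.2.2

/-- **bsd.S28 from seven leaves.** bsd.S28
(`bsdTriple_of_j_mem_maximalCMJInvariants_of_L_one_ne_zero`: the full Birch–Swinnerton-Dyer
statement for `E/ℚ` with CM by `𝓞_K` and `L(E,1) ≠ 0`; Burungale–Flach 2024, Thm. 1.1, Cor. 1,
Cor. 2) follows, sorry-free, from

1. `BurungaleFlach2024_main_cmField_pPart` (`hB`) — Prop. 2.3 with Lemma 13 at `F = K` for every
   `p` (the paper's contribution: Johnson-Leung–Kings, the descent Prop. 4.1, Kato's reciprocity);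
2. `Rubin1987_sha_primary_finite` (`hR`) — Rubin 1987, §10;
3. `CoatesWiles1977_L_one_div_period_mem_prime` (`h1`) — Coates–Wiles 1977, §6;
4. `Deuring_LFunction_baseChange_cmField` (`hD`) — Deuring, `L(E_K/K,s) = L(E/ℚ,s)²`;
5. `bsdRHS_baseChange_quadratic` (`hBC`) — Milne 1972, Thm. 1, rank-zero quotient form;
6. `bsdRHS_eq_of_isIsogenous` (`hISO`) — Cassels 1965 / Milne *ADT* I.7.3;
7. `re_entireLFunction_one_nonneg` (`hPOS`) — `L(E,1) ≥ 0` (Guo 1996; Lapid–Rallis 2003).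

The chain: `E(ℚ)` finite from Coates–Wiles §6 with Mordell–Weil and the nine singular moduli;
the finiteness half of Thm. 1.1 over `K` (`…_finite_primary_cmField_of_classical_leaves`);
Cor. 1 over `K` (`BurungaleFlach2024_bsd_cmField_of_printed_leaves_of_Deuring`); the level-6
descent; the level-2 assembly. Compared with `…_of_eight_leaves`: the Deuring–Hecke continuation
of `L(E/ℚ, s)` (Silverman *Advanced Topics* II Cor. 10.5.1) is gone, nothing is added.
[cite: BurungaleFlach2024, Thm. 1.1 and its proof, Cor. 1, Cor. 2, Remark 10 (arXiv pp. 3–4, 19, 22)] -/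
theorem bsdTriple_of_j_mem_maximalCMJInvariants_of_L_one_ne_zero_of_seven_leaves
    (hB : BurungaleFlach2024_main_cmField_pPart) (hR : Rubin1987_sha_primary_finite)
    (h1 : CoatesWiles1977_L_one_div_period_mem_prime)
    (hD : Deuring_LFunction_baseChange_cmField)
    (hBC : bsdRHS_baseChange_quadratic) (hISO : bsdRHS_eq_of_isIsogenous)
    (hPOS : re_entireLFunction_one_nonneg) :
    bsdTriple_of_j_mem_maximalCMJInvariants_of_L_one_ne_zero :=
  bsdTriple_of_j_mem_maximalCMJInvariants_of_L_one_ne_zero_of_level2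
    (BurungaleFlach2024_bsd_cmField_of_printed_leaves_of_Deuring
      (BurungaleFlach2024_finite_primary_cmField_of_classical_leaves
        (finite_point_of_j_mem_maximalCMJInvariants_of_L_one_ne_zero_of_pAdicDivisibility h1)
        hR hD)
      hB hD)
    (BurungaleFlach2024_bsd_rat_of_bsd_cmField_of_level6 hD hBC hISO hPOS)

/-! ### Theorem 1.1 over `K` from four leaves -/

/-- **Burungale–Flach, Theorem 1.1 with Remark 1 at `F = K`, from four leaves**: Prop. 2.3 with
Lemma 13 at `F = K` for every `p` (`hB`), Rubin 1987 §10 (`hR`), Coates–Wiles 1977 §6 (`h1`) and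
Deuring's identity (`hD`) — the census `BurungaleFlach2024_main_cmField_of_six_leaves`
(`…MainLeavesProofs.lean`) with Artin formalism and the Euler factors of the Tate module
replaced by the Deuring leaf they produced there, and the Deuring–Hecke continuation dropped:
the finiteness half from three leaves (`BurungaleFlach2024_finite_primary_cmField_of_three_leaves`),
the two halves being put together by the last paragraph of the printed proof
(`BurungaleFlach2024_main_cmField_of_halves`).
[cite: BurungaleFlach2024, Thm. 1.1 and Remark 1 (§1), proof of Thm. 1.1 (§4.5) with Prop. 2.3, Lemma 13, Prop. 4.1, Remark 10] -/
theorem BurungaleFlach2024_main_cmField_of_four_leaves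
    (hB : BurungaleFlach2024_main_cmField_pPart) (hR : Rubin1987_sha_primary_finite)
    (h1 : CoatesWiles1977_L_one_div_period_mem_prime)
    (hD : Deuring_LFunction_baseChange_cmField) : BurungaleFlach2024_main_cmField :=
  BurungaleFlach2024_main_cmField_of_halves
    (BurungaleFlach2024_finite_primary_cmField_of_three_leaves h1 hR hD) hB

/-- **Modulo Rubin 1987 §10, Coates–Wiles 1977 §6 and Deuring, Theorem 1.1 at `F = K` is
equivalent to its formula half** `BurungaleFlach2024_main_cmField_pPart` (Prop. 2.3 with Lemma 13
at `F = K` for every `p`): the forward direction is unconditional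
(`BurungaleFlach2024_main_cmField_pPart_of_main`), the backward one is the previous theorem.
Sharpens `BurungaleFlach2024_main_cmField_iff_pPart` (five classical leaves).
[cite: BurungaleFlach2024, proof of Thm. 1.1 (§4.5) with Prop. 2.3 and Lemma 13] -/
theorem BurungaleFlach2024_main_cmField_iff_pPart_of_three_leaves
    (hR : Rubin1987_sha_primary_finite) (h1 : CoatesWiles1977_L_one_div_period_mem_prime)
    (hD : Deuring_LFunction_baseChange_cmField) :
    BurungaleFlach2024_main_cmField ↔ BurungaleFlach2024_main_cmField_pPart :=
  ⟨BurungaleFlach2024_main_cmField_pPart_of_main,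
    fun hB => BurungaleFlach2024_main_cmField_of_four_leaves hB hR h1 hD⟩

end Literature.NumberTheory.EllipticCurves

end
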